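import Literature.NumberTheory.BeurlingPrimes.PrescribedZerosMultisetProofs
import Literature.NumberTheory.BeurlingPrimes.BDRMultisetContZeta
import Literature.NumberTheory.BeurlingPrimes.ErrorExponents
import Literature.NumberTheory.BeurlingPrimes.WellBehavedIntegers
import HarnessLib

/-!
# RiemannHypothesis / RuelleBand — support item `FiniteTowerAboveHalf` (finite off-line towers of Beurling zeta zeros)

Route `RiemannHypothesis/RuelleBand`, item stmt-RiemannHypothesis-24939 (`FiniteTowerAboveHalf`, support,
rank 9; negative dictionary rung of LINE «BEURLING INTEGER TOOTH», rh-idea-2 g3), signature verbatim: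

  `∀ θ Θ : ℝ, 1 / 2 < θ → θ < Θ → Θ < 1 → ∀ T : Finset ℝ, ∃ (P : BeurlingPrimes) (a : ℝ) (Z : ℂ → ℂ),
     0 < a ∧ P.IntErrorLE a θ ∧ P.IsZetaContinuation θ Z ∧
     ∀ s : ℂ, θ < s.re → s.re < 1 → (Z s = 0 ↔ s.re = Θ ∧ (s.im ∈ T ∨ -s.im ∈ T))`.

FINITE TOWER ABOVE ONE HALF: for every `1/2 < θ < Θ < 1` and every finite set `T` of ordinates there is
a discrete Beurling generalized prime system `P` with `N_P(x) = ax + O(x^θ)` (`a > 0`) whose zeta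
function continues analytically to `{Re s > θ} ∖ {1}` and whose zeros with `θ < Re s < 1` are EXACTLY the
points `Θ ± iγ`, `γ ∈ T`.

PROOF (a corollary of a PROVED tree theorem; no new analysis). Apply Broucke–Debruyne–Révész 2023,
Theorem 3.2 in its complex-multiset form, `Literature.NumberTheory.BeurlingPrimes.BrouckeDebruyneRevesz2023_thm32_multiset_holds`
(`PrescribedZerosMultisetProofs.lean`), with the symmetric multiset of zeros
`ℛ = {Θ + iγ : γ ∈ T} + {Θ − iγ : γ ∈ T}`, no poles (`𝒮 = ∅`) and `δ = 1/4`. It returns `P`, `a > 0`,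
`c > 0`, `M`, `Z₀` with `ζ_P = E_M · e^{Z₀}` on `Re s > 1` (`E_M = bdrE ℛ ∅ (1/4) M`, a rational function
with zeros exactly `ℛ` and poles only at `1, 0, 1/4`), `Z₀` holomorphic on `Re s > 0`, and
`|N_P(x) − ax| ≤ C x^{1/2} exp(c (log x)^{2/3})` (`x ≥ 2`). Take `Z := E_M · e^{Z₀}`
(tree `BDRMultiset.contZ`): it is the continuation (tree `BDRMultiset.differentiableAt_contZ`), the
integer bound is `O(x^θ)` for every `θ > 1/2` (tree `sqrt_mul_exp_log_rpow_le`,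
`intErrorLE_of_forall_ge`), and for `θ < Re s < 1` the only vanishing factor of `Z s` is
`∏_ℛ (s − ρ)/s` (`Multiset.prod_eq_zero_iff`).

MEANING (barrier record, RH-free): every analytic prime-side input of this shape (discrete g-primes,
`N`-regularity above `√x`, continuation) admits arbitrarily long finite off-line towers at any abscissa
`Θ ∈ (1/2, 1)`; no QUANTITATIVE "integer tooth" survives transfer to Beurling systems. This file has no
`sorry` and no named-fact hypothesis. Nothing here bears on the truth of RH; no summit statement is proved
by this file.

Sources: F. Broucke, G. Debruyne, Sz. Gy. Révész, arXiv:2309.01567 = Trans. AMS 378 (2025), Theorem 3.2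
(tree: `PrescribedZerosMultiset.lean`, `PrescribedZerosMultisetProofs.lean`, `BDRMultisetContZeta.lean`).
-/

-- D-0017: a single-problem summit has `RiemannHypothesis.RiemannHypothesis` in every name by
-- design; the lakefile turns this linter off for `Summits`; repeated here so that standalone
-- elaboration is warning-free as well.
set_option linter.dupNamespace false

noncomputable section

namespace Summit.RiemannHypothesis.RiemannHypothesis.Theorems

open Literature.Barriers.RiemannHypothesis Literature.NumberTheory.BeurlingPrimes

/-- The tower multiset `{Θ + iγ : γ ∈ T} + {Θ − iγ : γ ∈ T}` is symmetric under complex conjugation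
(conjugation swaps the two summands). [folklore] -/
theorem ruelleBand_finiteTower_map_conj (Θ : ℝ) (T : Finset ℝ) :
    (T.val.map (fun γ : ℝ ↦ (⟨Θ, γ⟩ : ℂ)) + T.val.map (fun γ : ℝ ↦ (⟨Θ, -γ⟩ : ℂ))).map (starRingEnd ℂ) =
      T.val.map (fun γ : ℝ ↦ (⟨Θ, γ⟩ : ℂ)) + T.val.map (fun γ : ℝ ↦ (⟨Θ, -γ⟩ : ℂ)) := by
  have h1 : T.val.map ((starRingEnd ℂ) ∘ fun γ : ℝ ↦ (⟨Θ, γ⟩ : ℂ)) = T.val.map (fun γ : ℝ ↦ (⟨Θ, -γ⟩ : ℂ)) :=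
    Multiset.map_congr rfl fun γ _ ↦ Complex.ext (by simp) (by simp)
  have h2 : T.val.map ((starRingEnd ℂ) ∘ fun γ : ℝ ↦ (⟨Θ, -γ⟩ : ℂ)) = T.val.map (fun γ : ℝ ↦ (⟨Θ, γ⟩ : ℂ)) :=
    Multiset.map_congr rfl fun γ _ ↦ Complex.ext (by simp) (by simp)
  rw [Multiset.map_add, Multiset.map_map, Multiset.map_map, h1, h2]
  exact add_comm _ _

/-- Membership in the tower multiset: `ρ ∈ {Θ + iγ : γ ∈ T} + {Θ − iγ : γ ∈ T}` iff `Re ρ = Θ` and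
`Im ρ ∈ T` or `−Im ρ ∈ T`. [folklore] -/
theorem ruelleBand_finiteTower_mem_iff (Θ : ℝ) (T : Finset ℝ) (ρ : ℂ) :
    ρ ∈ T.val.map (fun γ : ℝ ↦ (⟨Θ, γ⟩ : ℂ)) + T.val.map (fun γ : ℝ ↦ (⟨Θ, -γ⟩ : ℂ)) ↔
      ρ.re = Θ ∧ (ρ.im ∈ T ∨ -ρ.im ∈ T) := by
  simp only [Multiset.mem_add, Multiset.mem_map, Finset.mem_val]
  constructor
  · rintro (⟨γ, hγ, rfl⟩ | ⟨γ, hγ, rfl⟩)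
    · exact ⟨rfl, Or.inl hγ⟩
    · exact ⟨rfl, Or.inr (by simpa using hγ)⟩
  · rintro ⟨hre, hγ | hγ⟩
    · exact Or.inl ⟨ρ.im, hγ, Complex.ext hre.symm rfl⟩
    · exact Or.inr ⟨-ρ.im, hγ, Complex.ext hre.symm (neg_neg ρ.im)⟩

/-- Zeros of the continued zeta function `E_M(s) e^{Z(s)}` (no poles prescribed, `𝒮 = ∅`): away from
`s = 0, 1, δ` it vanishes exactly on the zero multiset `ℛ` — the factors `s/(s−1)`, `(s/(s−δ))^M`,
`e^{Z(s)}` do not vanish and `∏_ℛ (s−ρ)/s = 0 ↔ s ∈ ℛ`.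
[cite: BrouckeDebruyneRevesz2023, Theorem 3.2 ("its zeros in this half-plane are precisely the elements of ℛ")] -/
theorem ruelleBand_finiteTower_contZ_eq_zero_iff {R : Multiset ℂ} {δ : ℝ} {M : ℕ} {Z : ℂ → ℂ} {s : ℂ}
    (hs0 : s ≠ 0) (hs1 : s ≠ 1) (hsδ : s ≠ (δ : ℂ)) :
    BDRMultiset.contZ R ∅ δ M Z s = 0 ↔ s ∈ R := by
  have h1 : s / (s - 1) ≠ 0 := div_ne_zero hs0 (sub_ne_zero.2 hs1)
  have h2 : (s / (s - δ)) ^ M ≠ 0 := pow_ne_zero _ (div_ne_zero hs0 (sub_ne_zero.2 hsδ))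
  have h3 : Complex.exp (Z s) ≠ 0 := Complex.exp_ne_zero _
  have hE : BDRMultiset.contZ R ∅ δ M Z s = 0 ↔ (R.map fun ρ ↦ (s - ρ) / s).prod = 0 := by
    simp only [BDRMultiset.contZ, bdrE, Multiset.empty_eq_zero, Multiset.map_zero, Multiset.prod_zero, mul_one]
    constructor
    · intro h
      rcases mul_eq_zero.1 h with h | h
      · rcases mul_eq_zero.1 h with h | h
        · rcases mul_eq_zero.1 h with h | h
          · exact absurd h h1
          · exact h
        · exact absurd h h2
      · exact absurd h h3
    · intro h
      rw [h, mul_zero, zero_mul, zero_mul]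
  rw [hE, Multiset.prod_eq_zero_iff, Multiset.mem_map]
  constructor
  · rintro ⟨ρ, hρ, h0⟩
    rcases (div_eq_zero_iff.1 h0) with h | h
    · rwa [sub_eq_zero.1 h]
    · exact absurd h hs0
  · intro hs
    exact ⟨s, hs, by rw [sub_self, zero_div]⟩

/-- The Broucke–Vindas / BDR integer remainder is `O(x^θ)` for every `θ > 1/2`:
`|N_P(x) − ax| ≤ C x^{1/2} exp(c (log x)^{2/3})` for `x ≥ 2` gives `IntErrorLE a θ` (global bound on
`x ≥ 1`; `N_P` is monotone on `[1, 2]`). [folklore] -/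
theorem ruelleBand_finiteTower_intErrorLE {P : BeurlingPrimes} {a c C θ : ℝ} (hc : 0 < c)
    (hθ : 1 / 2 < θ)
    (hN : ∀ x : ℝ, 2 ≤ x →
      |(P.intCount x : ℝ) - a * x| ≤ C * (x ^ (1 / 2 : ℝ) * Real.exp (c * Real.log x ^ (2 / 3 : ℝ)))) :
    P.IntErrorLE a θ := by
  obtain ⟨D, hD, hDle⟩ := sqrt_mul_exp_log_rpow_le hc (ε := θ - 1 / 2) (by linarith)
  refine P.intErrorLE_of_forall_ge (X := 2) (C := max C 0 * D) (by linarith) fun x hx ↦ ?_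
  have hx1 : 1 ≤ x := by linarith
  have h1 := hDle x hx1
  rw [show (1 : ℝ) / 2 + (θ - 1 / 2) = θ by ring] at h1
  calc |(P.intCount x : ℝ) - a * x|
      ≤ C * (x ^ (1 / 2 : ℝ) * Real.exp (c * Real.log x ^ (2 / 3 : ℝ))) := hN x hx
    _ ≤ max C 0 * (x ^ (1 / 2 : ℝ) * Real.exp (c * Real.log x ^ (2 / 3 : ℝ))) :=
        mul_le_mul_of_nonneg_right (le_max_left _ _) (by positivity)
    _ ≤ max C 0 * (D * x ^ θ) := mul_le_mul_of_nonneg_left h1 (le_max_right _ _)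
    _ = max C 0 * D * x ^ θ := by ring

/-- **`FiniteTowerAboveHalf`** (item stmt-RiemannHypothesis-24939, signature verbatim): for every
`1/2 < θ < Θ < 1` and every finite set `T ⊂ ℝ` there is a Beurling generalized prime system `P`, `a > 0`
and `Z : ℂ → ℂ` with `N_P(x) = ax + O(x^θ)` (`IntErrorLE a θ`), `Z` an analytic continuation of `ζ_P` to
`{Re s > θ} ∖ {1}` (`IsZetaContinuation θ Z`), and, for `θ < Re s < 1`,
`Z s = 0 ↔ Re s = Θ ∧ (Im s ∈ T ∨ −Im s ∈ T)` — a finite tower of zeros on `Re s = Θ` and nothing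
else in the strip `θ < Re s < 1`. Corollary of Broucke–Debruyne–Révész 2023, Theorem 3.2
(`BrouckeDebruyneRevesz2023_thm32_multiset_holds`) with `ℛ = {Θ ± iγ : γ ∈ T}`, `𝒮 = ∅`, `δ = 1/4`,
`Z = E_M e^{Z₀}`. [cite: BrouckeDebruyneRevesz2023, Theorem 3.2] -/
theorem ruelleBand_finiteTowerAboveHalf :
    ∀ θ Θ : ℝ, 1 / 2 < θ → θ < Θ → Θ < 1 → ∀ T : Finset ℝ,
      ∃ (P : Literature.Barriers.RiemannHypothesis.BeurlingPrimes) (a : ℝ) (Z : ℂ → ℂ),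
        0 < a ∧ P.IntErrorLE a θ ∧ P.IsZetaContinuation θ Z ∧
        ∀ s : ℂ, θ < s.re → s.re < 1 → (Z s = 0 ↔ s.re = Θ ∧ (s.im ∈ T ∨ -s.im ∈ T)) := by
  intro θ Θ hθ hθΘ hΘ1 T
  set R : Multiset ℂ := T.val.map (fun γ : ℝ ↦ (⟨Θ, γ⟩ : ℂ)) + T.val.map (fun γ : ℝ ↦ (⟨Θ, -γ⟩ : ℂ))
    with hR
  have hmem : ∀ ρ : ℂ, ρ ∈ R ↔ ρ.re = Θ ∧ (ρ.im ∈ T ∨ -ρ.im ∈ T) := fun ρ ↦ by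
    rw [hR]; exact ruelleBand_finiteTower_mem_iff Θ T ρ
  have hsymm : R.map (starRingEnd ℂ) = R := by
    rw [hR]; exact ruelleBand_finiteTower_map_conj Θ T
  have hRre : ∀ ρ ∈ R, 0 < ρ.re ∧ ρ.re < 1 := fun ρ hρ ↦ by
    rw [((hmem ρ).1 hρ).1]; exact ⟨by linarith, hΘ1⟩
  obtain ⟨P, a, c, b, M, Z₀, ha, hc, -, -, -, ⟨C₂, hN⟩, hζ, hZ₀, -⟩ :=
    BrouckeDebruyneRevesz2023_thm32_multiset_holds R ∅ (1 / 4) hsymm (by simp) disjoint_bot_right hRre (by simp)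
      (by norm_num) (by norm_num)
  refine ⟨P, a, BDRMultiset.contZ R ∅ (1 / 4) M Z₀, ha, ?_, ⟨fun s hs ↦ ?_, fun z hz ↦ ?_⟩,
    fun s hθs hs1 ↦ ?_⟩
  · -- `IntErrorLE a θ`
    refine ruelleBand_finiteTower_intErrorLE (C := C₂) hc hθ fun x hx ↦ ?_
    have h := hN x hx
    have e : (P.intCount x : ℂ) -
        (((a * x : ℝ) : ℂ) + ∑ ω ∈ (∅ : Multiset ℂ).toFinset.filter (fun ω ↦ 1 / 2 < ω.re),
          (x : ℂ) ^ ω * ∑ j ∈ Finset.range ((∅ : Multiset ℂ).count ω),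
            b ω j * ((Real.log x : ℝ) : ℂ) ^ j) =
        (((P.intCount x : ℝ) - a * x : ℝ) : ℂ) := by
      push_cast; simp
    rwa [e, Complex.norm_real, Real.norm_eq_abs] at h
  · -- `Z = ζ_P` on `Re s > 1`
    rw [BDRMultiset.contZ, hζ s hs]
  · -- holomorphy on `{θ < Re s} ∖ {1}`
    have hz' : 1 / 2 < z.re := lt_trans hθ hz.1
    have hz0 : 0 < z.re := by linarith
    refine (BDRMultiset.differentiableAt_contZ (by norm_num) hz' hz.2 (by simp) ?_).differentiableWithinAt
    exact hZ₀.differentiableAt ((isOpen_lt continuous_const Complex.continuous_re).mem_nhds hz0)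
  · -- the zeros with `θ < Re s < 1`
    have hs0 : s ≠ 0 := fun h ↦ by rw [h, Complex.zero_re] at hθs; linarith
    have hs1' : s ≠ 1 := fun h ↦ by rw [h, Complex.one_re] at hs1; linarith
    have hsδ : s ≠ ((1 / 4 : ℝ) : ℂ) := fun h ↦ by rw [h, Complex.ofReal_re] at hθs; linarith
    rw [ruelleBand_finiteTower_contZ_eq_zero_iff hs0 hs1' hsδ]
    exact hmem s

end Summit.RiemannHypothesis.RiemannHypothesis.Theorems

end
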